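import Summits.AtomisticToContinuum.HydrodynamicLimit.Theses.JParityClosure
import Literature.Analysis.FluidPDE.ConfinedHardSphereFlowShortBad

/-!
# The Enskog pair functional of `EvenStressEnskog`: where it vanishes identically

Negative knowledge for the crux `JParityClosure.EvenStressEnskog` (stmt-AtomisticToContinuum-13079), from the
standing disprover's `Cruxes/EvenStressEnskog/Disproof.lean` §4. The subtracted (Enskog) term of the crux is
`σ³ ∫∫ χ g(σ³ρ_r) Y(σ³ρ_r) B_r` with the `r`-mollified pair functional
`B_r Ξ z x₀ = ∫∫ b_r(x,x₀) b_r(y,x₀) Θ Ξ v w dμ_z(x,v) dμ_z(y,w)` over the empirical measure `μ_z` of the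
configuration (cone mollifier `b_r(x,y) = 3/(πr³)(1 − dist(x,y)/r)₊`, `Θ Ξ v w = ∫ Ξ(ω,v,w)((w−v)·ω)₊ dω`,
diagonal included). All expressions below are VERBATIM the `let`-bodies of the crux. Two facts, both proved by
showing that the integrand vanishes on every ordered pair of particles (`μ_z ⊗ μ_z` is carried by
`range z × range z`):

* **limit order is load-bearing** — on the hard-sphere domain of diameter `ε`, `B_r ≡ 0` as soon as `2r < ε`
  (two distinct spheres never share a cone of radius `r`; the diagonal carries `Θ Ξ v v = 0`): with
  `r = r_N < ε_N/2` the Enskog term is `0` surely and the crux would degenerate into the (physically false,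
  formally unrefutable) `K_N[χ g Ξ_P] → 0`; the filed order `∃ r₀ ∀ r < r₀ ∃ N₀ ∀ N ≥ N₀` is essential;
* **the `Y 0 = 0` junk is harmless** (`Negative/ContactValueZero.lean`) — wherever the mollified density
  `ρ_r(x₀) = ∫ b_r(x,x₀) dμ_z` vanishes, so does `B_r Ξ z x₀`: the Enskog integrand never reads `Y` at `0`
  with a nonzero weight.
refuter-cdisprove-stmt-AtomisticToContinuum-13079-0.
-/

noncomputable section

namespace Summit.AtomisticToContinuum.HydrodynamicLimit.Theorems

open MeasureTheory Filter Set
open scoped ENNReal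
open Literature.MathematicalPhysics.KineticTheory Literature.Analysis.FluidPDE

namespace EvenStressEnskog

/-- The diagonal never contributes: `Θ Ξ v v = 0`. [folklore] -/
theorem sphereMark_self (Ξ : V3 × V3 × V3 → ℝ) (v : V3) :
    ∫ ω : Metric.sphere (0 : V3) 1, Ξ ((ω : V3), v, v) * hardSphereKernel (v, v) ω ∂sphereMeasure = 0 := by
  simp [hardSphereKernel]

/-- The cone mollifier is nonnegative. [folklore] -/
theorem coneMollifier_nonneg {r : ℝ} (hr : 0 < r) (x y : T3) :
    0 ≤ 3 / (Real.pi * r ^ 3) * max (1 - Torus.euclidDist x y / r) 0 := by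
  refine mul_nonneg ?_ (le_max_right _ _)
  positivity

/-- The cone mollifier is supported in the open ball of radius `r`. [folklore] -/
theorem euclidDist_lt_of_coneMollifier_ne_zero {r : ℝ} (hr : 0 < r) {x y : T3}
    (h : 3 / (Real.pi * r ^ 3) * max (1 - Torus.euclidDist x y / r) 0 ≠ 0) : Torus.euclidDist x y < r := by
  by_contra hle
  push Not at hle
  apply h
  have : 1 - Torus.euclidDist x y / r ≤ 0 := by
    rw [sub_nonpos, le_div_iff₀ hr, one_mul]; exact hle
  rw [max_eq_right this, mul_zero]

/-- The empirical measure is carried by the particles. [folklore] -/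
theorem empiricalMeasure_compl_range {N : ℕ} (z : Config N (Fin 3) T3) :
    empiricalMeasure z (Set.range z)ᶜ = 0 := by
  have hS : MeasurableSet (Set.range z)ᶜ := (Set.finite_range z).measurableSet.compl
  rw [empiricalMeasure_eq, Measure.smul_apply, Measure.coe_finsetSum, Finset.sum_apply]
  have : ∀ i : Fin N, Measure.dirac (z i) (Set.range z)ᶜ = 0 := by
    intro i
    rw [Measure.dirac_apply' _ hS, Set.indicator_of_notMem]
    simp
  simp [this]

/-- `μ_z ⊗ μ_z`-a.e. pair is a pair of particles. [folklore] -/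
theorem ae_prod_empirical_mem_range {N : ℕ} (z : Config (N + 1) (Fin 3) T3) :
    ∀ᵐ p ∂((empiricalMeasure z).prod (empiricalMeasure z)),
      p.1 ∈ Set.range z ∧ p.2 ∈ Set.range z := by
  set μ := empiricalMeasure z with hμ
  have h0 : μ (Set.range z)ᶜ = 0 := empiricalMeasure_compl_range z
  have h1 : (μ.prod μ) ((Set.range z)ᶜ ×ˢ Set.univ) = 0 := by
    rw [Measure.prod_prod, h0, zero_mul]
  have h2 : (μ.prod μ) (Set.univ ×ˢ (Set.range z)ᶜ) = 0 := by
    rw [Measure.prod_prod, h0, mul_zero]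
  have h3 := measure_union_null h1 h2
  rw [ae_iff]
  refine measure_mono_null ?_ h3
  intro p hp
  simp only [Set.mem_setOf_eq, not_and_or] at hp
  rcases hp with hp | hp
  · exact Or.inl ⟨hp, Set.mem_univ _⟩
  · exact Or.inr ⟨Set.mem_univ _, hp⟩

/-- A pair integral against `μ_z ⊗ μ_z` vanishes as soon as its integrand vanishes on every ordered pair of
particles. [folklore] -/
theorem integral_prod_empirical_eq_zero {N : ℕ} (F : (T3 × V3) × (T3 × V3) → ℝ)
    (z : Config (N + 1) (Fin 3) T3) (h : ∀ i j, F (z i, z j) = 0) :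
    ∫ p, F p ∂((empiricalMeasure z).prod (empiricalMeasure z)) = 0 := by
  refine integral_eq_zero_of_ae ?_
  filter_upwards [ae_prod_empirical_mem_range z] with p hp
  rcases hp with ⟨⟨i, hi⟩, ⟨j, hj⟩⟩
  have : p = (z i, z j) := Prod.ext hi.symm hj.symm
  rw [this]
  simpa using h i j

/-- **Limit order is load-bearing.** On the hard-sphere domain of diameter `ε` the `r`-mollified pair functional
of the crux vanishes identically when `2r < ε`, for every mark `Ξ` and every centre `x₀`. [folklore] -/
theorem pairFunctional_eq_zero_of_two_r_lt {N : ℕ} {r ε : ℝ} (hr : 0 < r) (h2r : 2 * r < ε)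
    (Ξ : V3 × V3 × V3 → ℝ) (z : Config (N + 1) (Fin 3) T3)
    (hz : z ∈ hardSphereDomain (Torus.geometry (Fin 3)) (N + 1) ε) (x₀ : T3) :
    ∫ p, 3 / (Real.pi * r ^ 3) * max (1 - Torus.euclidDist p.1.1 x₀ / r) 0 *
        (3 / (Real.pi * r ^ 3) * max (1 - Torus.euclidDist p.2.1 x₀ / r) 0) *
        ∫ ω : Metric.sphere (0 : V3) 1, Ξ ((ω : V3), p.1.2, p.2.2) * hardSphereKernel (p.2.2, p.1.2) ω
          ∂sphereMeasure ∂((empiricalMeasure z).prod (empiricalMeasure z)) = 0 := by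
  refine integral_prod_empirical_eq_zero _ z fun i j => ?_
  simp only
  by_cases hij : i = j
  · subst hij; rw [sphereMark_self, mul_zero]
  by_cases hi : 3 / (Real.pi * r ^ 3) * max (1 - Torus.euclidDist (z i).1 x₀ / r) 0 = 0
  · rw [hi]; ring
  by_cases hj : 3 / (Real.pi * r ^ 3) * max (1 - Torus.euclidDist (z j).1 x₀ / r) 0 = 0
  · rw [hj]; ring
  exfalso
  have di := euclidDist_lt_of_coneMollifier_ne_zero hr hi
  have dj := euclidDist_lt_of_coneMollifier_ne_zero hr hj
  have hsep : ε ≤ Torus.euclidDist (z i).1 (z j).1 := by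
    have := (mem_hardSphereDomain.mp hz) i j hij
    rwa [Torus.norm_geometry_sepVec] at this
  have tri := Torus.euclidDist_triangle (z i).1 x₀ (z j).1
  rw [Torus.euclidDist_comm x₀] at tri
  linarith

/-- Along any hard-sphere flow the previous lemma applies at every time on the good set (good orbits stay in the
hard-sphere domain). [folklore] -/
theorem pairFunctional_flow_eq_zero_of_two_r_lt {N : ℕ} {r ε : ℝ} (hr : 0 < r) (h2r : 2 * r < ε)
    (Φ : HardSphereFlow (Torus.geometry (Fin 3)) ε (N + 1)) {z : Config (N + 1) (Fin 3) T3}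
    (hz : z ∈ Φ.good) (s : ℝ) (Ξ : V3 × V3 × V3 → ℝ) (x₀ : T3) :
    ∫ p, 3 / (Real.pi * r ^ 3) * max (1 - Torus.euclidDist p.1.1 x₀ / r) 0 *
        (3 / (Real.pi * r ^ 3) * max (1 - Torus.euclidDist p.2.1 x₀ / r) 0) *
        ∫ ω : Metric.sphere (0 : V3) 1, Ξ ((ω : V3), p.1.2, p.2.2) * hardSphereKernel (p.2.2, p.1.2) ω
          ∂sphereMeasure
      ∂((empiricalMeasure (Φ.flow s z)).prod (empiricalMeasure (Φ.flow s z))) = 0 :=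
  pairFunctional_eq_zero_of_two_r_lt hr h2r Ξ _ ((Φ.isTrajectory z hz).mem s) x₀

/-- **The `Y 0` junk is harmless.** Where the mollified density `ρ_r(x₀) = ∫ b_r(x,x₀) dμ_z` vanishes, so does
the pair functional, for every mark. [folklore] -/
theorem pairFunctional_eq_zero_of_mollifiedDensity_eq_zero {N : ℕ} {r : ℝ} (hr : 0 < r)
    (Ξ : V3 × V3 × V3 → ℝ) (z : Config (N + 1) (Fin 3) T3) (x₀ : T3)
    (h : ∫ q, 3 / (Real.pi * r ^ 3) * max (1 - Torus.euclidDist q.1 x₀ / r) 0 ∂(empiricalMeasure z) = 0) :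
    ∫ p, 3 / (Real.pi * r ^ 3) * max (1 - Torus.euclidDist p.1.1 x₀ / r) 0 *
        (3 / (Real.pi * r ^ 3) * max (1 - Torus.euclidDist p.2.1 x₀ / r) 0) *
        ∫ ω : Metric.sphere (0 : V3) 1, Ξ ((ω : V3), p.1.2, p.2.2) * hardSphereKernel (p.2.2, p.1.2) ω
          ∂sphereMeasure ∂((empiricalMeasure z).prod (empiricalMeasure z)) = 0 := by
  have hsum : ∑ i, 3 / (Real.pi * r ^ 3) * max (1 - Torus.euclidDist (z i).1 x₀ / r) 0 = 0 := by
    rw [integral_empiricalMeasure] at h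
    have hN : ((N + 1 : ℕ) : ℝ)⁻¹ ≠ 0 := by positivity
    exact (mul_eq_zero.mp h).resolve_left hN
  have hall : ∀ i, 3 / (Real.pi * r ^ 3) * max (1 - Torus.euclidDist (z i).1 x₀ / r) 0 = 0 := by
    intro i
    exact (Finset.sum_eq_zero_iff_of_nonneg fun k _ => coneMollifier_nonneg hr (z k).1 x₀).mp hsum i
      (Finset.mem_univ i)
  refine integral_prod_empirical_eq_zero _ z fun i j => ?_
  simp only
  rw [hall i]; ring

end EvenStressEnskog

end Summit.AtomisticToContinuum.HydrodynamicLimit.Theorems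

end
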